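import Mathlib
import Summits.KontsevichZagierPeriods.KontsevichZagierPeriods.Theorems.SoloInformedGermAlgebra
import HarnessLib

/-!
# SoloInformed — Jacobians of polynomial maps

For `p ∈ ℚ[s₁, …, sₘ]ⁿ` the real polynomial map `κ_p = soloInformedPolyMap p : ℝᵐ → ℝⁿ` is
differentiable with derivative the **symbolic Jacobian** `(∂pⱼ/∂sᵢ)` evaluated at the point
(`soloInformed_hasFDerivAt_polyMap`), and for `n = m` its determinant is the evaluation of the
symbolic determinant `det (∂pⱼ/∂sᵢ) ∈ ℚ[s]` (`soloInformed_det_jacCLM`). These feed the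
cubulation-from-triangulation construction (`SoloInformedNashSimplex`): the Jacobian of a polynomial
change of variables is (the real part of) a polynomial cube germ. The last section sets up the
prefix products `∏_{i ≤ j} xᵢ` (the monomial map `κ` of `SoloInformedNashSimplex`): recursion,
injectivity on vectors with non-zero entries, and the explicit inverse `sⱼ = tⱼ / tⱼ₋₁`.
-/

noncomputable section

open scoped BigOperators
open Set
open Literature.NumberTheory.Transcendental

namespace Summit.KontsevichZagierPeriods.KontsevichZagierPeriods.Theorems

variable {m n : ℕ}

/-- The symbolic Jacobian matrix `(∂pⱼ/∂sᵢ)ⱼᵢ ∈ ℚ[s]ⁿˣᵐ`. -/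
def soloInformedJacMat (p : Fin n → MvPolynomial (Fin m) ℚ) :
    Matrix (Fin n) (Fin m) (MvPolynomial (Fin m) ℚ) :=
  Matrix.of fun j i => MvPolynomial.pderiv i (p j)

/-- Entries of the symbolic Jacobian matrix: `∂ pᵢ / ∂ xⱼ`. -/
@[simp] theorem soloInformedJacMat_apply (p : Fin n → MvPolynomial (Fin m) ℚ) (j : Fin n)
    (i : Fin m) : soloInformedJacMat p j i = MvPolynomial.pderiv i (p j) := rfl

/-- The derivative of the scalar polynomial function `y ↦ q(y)` at `x`, as a continuous linear
form: `v ↦ ∑ᵢ (∂q/∂sᵢ)(x) vᵢ`. -/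
def soloInformedGradCLM (q : MvPolynomial (Fin m) ℚ) (x : Fin m → ℝ) : (Fin m → ℝ) →L[ℝ] ℝ :=
  ∑ i, (MvPolynomial.aeval x (MvPolynomial.pderiv i q) : ℝ) • ContinuousLinearMap.proj i

/-- Evaluation formula for the gradient functional of a polynomial at a point. -/
@[simp] theorem soloInformedGradCLM_apply (q : MvPolynomial (Fin m) ℚ) (x v : Fin m → ℝ) :
    soloInformedGradCLM q x v = ∑ i, MvPolynomial.aeval x (MvPolynomial.pderiv i q) * v i := by
  simp [soloInformedGradCLM]

/-- **Polynomial functions are differentiable with the symbolic gradient.** [folklore] -/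
theorem soloInformed_hasFDerivAt_aeval (q : MvPolynomial (Fin m) ℚ) (x : Fin m → ℝ) :
    HasFDerivAt (fun y : Fin m → ℝ => (MvPolynomial.aeval y q : ℝ))
      (soloInformedGradCLM q x) x := by
  induction q using MvPolynomial.induction_on with
  | C a =>
    have h0 : soloInformedGradCLM (MvPolynomial.C a : MvPolynomial (Fin m) ℚ) x = 0 := by
      ext v; simp
    rw [h0]
    simpa using hasFDerivAt_const ((algebraMap ℚ ℝ) a) x
  | add p q hp hq =>
    have h1 : soloInformedGradCLM (p + q) x =
        soloInformedGradCLM p x + soloInformedGradCLM q x := by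
      ext v; simp [Finset.sum_add_distrib, add_mul]
    have hfun : (fun y : Fin m → ℝ => (MvPolynomial.aeval y (p + q) : ℝ)) =
        fun y => MvPolynomial.aeval y p + MvPolynomial.aeval y q := funext fun y => by simp
    rw [h1, hfun]
    exact hp.add hq
  | mul_X p i hp =>
    have hX : HasFDerivAt (fun y : Fin m → ℝ => y i)
        (ContinuousLinearMap.proj (R := ℝ) (φ := fun _ : Fin m => ℝ) i) x :=
      hasFDerivAt_apply (𝕜 := ℝ) i x
    have h := hp.mul hX
    have h2 : soloInformedGradCLM (p * MvPolynomial.X i) x =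
        (MvPolynomial.aeval x p : ℝ) • ContinuousLinearMap.proj i +
          x i • soloInformedGradCLM p x := by
      ext v
      simp only [soloInformedGradCLM_apply, MvPolynomial.pderiv_mul, MvPolynomial.pderiv_X,
        map_add, map_mul, MvPolynomial.aeval_X, _root_.add_apply,
        FunLike.coe_smul, Pi.smul_apply, ContinuousLinearMap.proj_apply, smul_eq_mul,
        add_mul, Finset.sum_add_distrib, Finset.mul_sum]
      rw [add_comm]
      congr 1
      · rw [Finset.sum_eq_single i (fun l _ hl => by simp [hl])
          (fun h => (h (Finset.mem_univ i)).elim)]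
        simp
      · exact Finset.sum_congr rfl fun l _ => by ring
    have hfun : (fun y : Fin m → ℝ => (MvPolynomial.aeval y (p * MvPolynomial.X i) : ℝ)) =
        fun y => MvPolynomial.aeval y p * y i := funext fun y => by simp
    rw [h2, hfun]
    exact h

/-- The derivative of `κ_p` at `x` as a continuous linear map (rows = symbolic gradients). -/
def soloInformedJacCLM (p : Fin n → MvPolynomial (Fin m) ℚ) (x : Fin m → ℝ) :
    (Fin m → ℝ) →L[ℝ] (Fin n → ℝ) :=
  ContinuousLinearMap.pi fun j => soloInformedGradCLM (p j) x

/-- Evaluation formula for the Jacobian linear map of a polynomial tuple at a point. -/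
@[simp] theorem soloInformedJacCLM_apply (p : Fin n → MvPolynomial (Fin m) ℚ) (x v : Fin m → ℝ)
    (j : Fin n) : soloInformedJacCLM p x v j =
      ∑ i, MvPolynomial.aeval x (MvPolynomial.pderiv i (p j)) * v i := by
  simp [soloInformedJacCLM]

/-- **Polynomial maps are differentiable with the symbolic Jacobian.** [folklore] -/
theorem soloInformed_hasFDerivAt_polyMap (p : Fin n → MvPolynomial (Fin m) ℚ) (x : Fin m → ℝ) :
    HasFDerivAt (soloInformedPolyMap p) (soloInformedJacCLM p x) x :=
  hasFDerivAt_pi.2 fun j => soloInformed_hasFDerivAt_aeval (p j) x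

/-- The Jacobian as the linear map of the evaluated symbolic matrix. -/
theorem soloInformed_jacCLM_eq_toLin' (p : Fin n → MvPolynomial (Fin m) ℚ) (x : Fin m → ℝ) :
    (soloInformedJacCLM p x : (Fin m → ℝ) →ₗ[ℝ] (Fin n → ℝ)) =
      Matrix.toLin' ((soloInformedJacMat p).map fun q => (MvPolynomial.aeval x q : ℝ)) := by
  refine LinearMap.ext fun v => funext fun j => ?_
  simp [Matrix.toLin'_apply, Matrix.mulVec, dotProduct]

/-- **The Jacobian determinant is the evaluated symbolic determinant.** [folklore] -/
theorem soloInformed_det_jacCLM (p : Fin m → MvPolynomial (Fin m) ℚ) (x : Fin m → ℝ) :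
    (soloInformedJacCLM p x).det = MvPolynomial.aeval x (soloInformedJacMat p).det := by
  rw [ContinuousLinearMap.det, soloInformed_jacCLM_eq_toLin', LinearMap.det_toLin', AlgHom.map_det,
    AlgHom.mapMatrix_apply]

/-! ### Prefix products and the monomial map -/

/-- Prefix products `∏_{i ≤ j} xᵢ`. -/
def soloInformedPrefixProd {A : Type*} [CommMonoid A] (x : Fin m → A) (j : Fin m) : A :=
  ∏ i ∈ Finset.univ.filter (fun i : Fin m => i ≤ j), x i

/-- The monomials `μⱼ = ∏_{i ≤ j} Xᵢ ∈ ℚ[s₁, …, sₘ]`. -/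
def soloInformedMonoPoly (m : ℕ) (j : Fin m) : MvPolynomial (Fin m) ℚ :=
  soloInformedPrefixProd MvPolynomial.X j

/-- Evaluation of the prefix-product monomial polynomial. -/
theorem soloInformed_aeval_monoPoly {A : Type*} [CommRing A] [Algebra ℚ A] (x : Fin m → A)
    (j : Fin m) :
    MvPolynomial.aeval x (soloInformedMonoPoly m j) = soloInformedPrefixProd x j := by
  unfold soloInformedMonoPoly soloInformedPrefixProd
  rw [map_prod]
  exact Finset.prod_congr rfl fun i _ => MvPolynomial.aeval_X x i

/-- The index filter `{j | j ≤ i+1}` decomposes off its last element. -/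
theorem soloInformed_filter_le_succ (j : Fin m) (h : j.1 + 1 < m) :
    Finset.univ.filter (fun i : Fin m => i ≤ ⟨j.1 + 1, h⟩) =
      insert ⟨j.1 + 1, h⟩ (Finset.univ.filter (fun i : Fin m => i ≤ j)) := by
  ext i
  simp only [Finset.mem_filter, Finset.mem_univ, true_and, Finset.mem_insert, Fin.le_def,
    Fin.ext_iff]
  omega

/-- The index filter `{j | j ≤ i+1}` as an `insert`. -/
theorem soloInformed_filter_le_eq_insert (j : Fin m) :
    Finset.univ.filter (fun i : Fin m => i ≤ j) =
      insert j (Finset.univ.filter (fun i : Fin m => i < j)) := by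
  ext i
  simp only [Finset.mem_filter, Finset.mem_univ, true_and, Finset.mem_insert]
  exact le_iff_eq_or_lt

/-- The prefix product at index `0` is the first coordinate. -/
theorem soloInformed_prefixProd_zero {A : Type*} [CommMonoid A] (x : Fin m → A) (h : 0 < m) :
    soloInformedPrefixProd x ⟨0, h⟩ = x ⟨0, h⟩ := by
  have hs : Finset.univ.filter (fun i : Fin m => i ≤ ⟨0, h⟩) = {⟨0, h⟩} := by
    ext i
    simp [Fin.le_def, Fin.ext_iff]
  simp [soloInformedPrefixProd, hs]

/-- Recursion for prefix products: `P_{i+1} = P_i * x_{i+1}`. -/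
theorem soloInformed_prefixProd_succ {A : Type*} [CommMonoid A] (x : Fin m → A) (j : Fin m)
    (h : j.1 + 1 < m) :
    soloInformedPrefixProd x ⟨j.1 + 1, h⟩ = x ⟨j.1 + 1, h⟩ * soloInformedPrefixProd x j := by
  rw [soloInformedPrefixProd, soloInformed_filter_le_succ j h, Finset.prod_insert]
  · rfl
  · simp only [Finset.mem_filter, Finset.mem_univ, true_and, Fin.le_def]
    omega

/-- A prefix product splits as the previous prefix product times the last factor. -/
theorem soloInformed_prefixProd_eq_mul {A : Type*} [CommMonoid A] (x : Fin m → A) (j : Fin m) :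
    soloInformedPrefixProd x j = x j * ∏ i ∈ Finset.univ.filter (fun i : Fin m => i < j), x i := by
  rw [soloInformedPrefixProd, soloInformed_filter_le_eq_insert, Finset.prod_insert]
  simp

/-- **Injectivity of prefix products** on vectors with non-zero entries. -/
theorem soloInformed_prefixProd_injective {K : Type*} [Field K] {x x' : Fin m → K}
    (hx : ∀ j, x j ≠ 0) (h : ∀ j, soloInformedPrefixProd x j = soloInformedPrefixProd x' j) :
    x = x' := by
  have key : ∀ k (hk : k < m), x ⟨k, hk⟩ = x' ⟨k, hk⟩ := by
    intro k
    induction k with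
    | zero => intro hk; simpa [soloInformed_prefixProd_zero] using h ⟨0, hk⟩
    | succ k ih =>
      intro hk
      have h1 := h ⟨k + 1, hk⟩
      rw [soloInformed_prefixProd_succ x ⟨k, by omega⟩ hk,
        soloInformed_prefixProd_succ x' ⟨k, by omega⟩ hk, ← h ⟨k, by omega⟩] at h1
      exact mul_right_cancel₀ (Finset.prod_ne_zero_iff.mpr fun i _ => hx i) h1
  exact funext fun j => key j.1 j.2

/-- The inverse of the prefix-product map: `s₁ = t₁`, `sⱼ = tⱼ / tⱼ₋₁`. -/
def soloInformedPrefixInv {K : Type*} [Field K] (t : Fin m → K) (j : Fin m) : K :=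
  if h : j.1 = 0 then t j else t j / t ⟨j.1 - 1, by omega⟩

/-- The prefix-product map is inverted by successive quotients. -/
theorem soloInformed_prefixProd_prefixInv {K : Type*} [Field K] (t : Fin m → K)
    (ht : ∀ j, t j ≠ 0) (j : Fin m) :
    soloInformedPrefixProd (soloInformedPrefixInv t) j = t j := by
  have key : ∀ k (hk : k < m),
      soloInformedPrefixProd (soloInformedPrefixInv t) ⟨k, hk⟩ = t ⟨k, hk⟩ := by
    intro k
    induction k with
    | zero => intro hk; simp [soloInformed_prefixProd_zero, soloInformedPrefixInv]
    | succ k ih =>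
      intro hk
      rw [soloInformed_prefixProd_succ _ ⟨k, by omega⟩ hk, ih (by omega)]
      simp only [soloInformedPrefixInv, Nat.add_eq_zero_iff, one_ne_zero, and_false, ↓reduceDIte,
        Nat.add_sub_cancel]
      exact div_mul_cancel₀ _ (ht _)
  exact key j.1 j.2

end Summit.KontsevichZagierPeriods.KontsevichZagierPeriods.Theorems
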